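import Literature.AlgebraicGeometry.HodgeTheory.WeilClassesFourfoldsStep2
import Literature.AlgebraicGeometry.HodgeTheory.GysinBaseChangeOfKunneth
import Literature.AlgebraicGeometry.HodgeTheory.GysinBaseChange
import Literature.AlgebraicGeometry.HodgeTheory.SupportedHodgeClassDescent
import Literature.AlgebraicGeometry.HodgeTheory.HodgeIndexSurface
import Literature.AlgebraicGeometry.HodgeTheory.ComplexConjugation
import Literature.AlgebraicGeometry.HodgeTheory.GysinKernelProofs
import Literature.AlgebraicTopology.SingularHomology.GysinMapSupportProofs
import HarnessLib

/-!
# `ProductDescent` (stmt-HodgeConjecture-14498) · I · Schoen's transfer along the tree's real Gysin maps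

Route `HeckePrymWeil`, support item `ProductDescent` (Schoen, Compositio Math. 114 (1998), §10,
Proposition and proof, pp. 332–333; Markman, arXiv:2509.23403 §11.5 Step 2; Koike,
doi:10.4153/cmb-2004-055-x): the DOWNWARD half of the product step. Given a rational `(n,n)` Weil
class `w = w₊ + w₋` of `(A, φ)` and a partner Weil surface `(B, ψ)` with a rational `(1,1)` Weil
class `b = b₊ + b₋`, the product step makes `pr_A^* w± ∪ pr_B^* b±` algebraic on `A × B`
(upward half, `Theorems/HeckePrymWeilWeilDescendingUpward`); Schoen's transfer
`pr_{A*}((pr_A^* w± ∪ pr_B^* b±) ∪ pr_B^* t) = ε± · w±` along the first projection returns `w±`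
algebraic on `A` as soon as `t` is an ALGEBRAIC class of `B` with `b± ∪ t ≠ 0`.

This file proves the transfer on the tree's REAL carriers, along the Gysin morphisms
`complexGysin μ` of `HodgeTheory/ComplexGysin` (Poincaré duality, the Künneth spanning property and
the compatibility of Gysin maps with restriction to Zariski-open complements are THEOREMS of the
tree: `OrientationFamily.hasPoincareDuality`, `kunnethSpan_complexBetti`,
`gysinMap_restrictCompl_eq_zero_of_field`), so that NO Gysin formalism is assumed:

* `conjClass_cupProduct` — complex conjugation on `H*(Y; ℂ)` is multiplicative;
* `conjClass_eigencomponent_eq` — for a real operator `f^*` and a RATIONAL `b = b₊ + b₋` with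
  `f^* b₊ = α b₊`, `f^* b₋ = ᾱ b₋`, `α ≠ ᾱ`: `conj b₊ = b₋`;
* `complexGysin_fst_cupProduct_cupProduct_map_snd`, `mem_algebraicClasses_of_complexGysin_fst_cupProduct`
  — the projection-formula shape `pr_{1*}((pr₁^*c ∪ pr₂^*u) ∪ pr₂^*η) = c ∪ pr_{1*}pr₂^*(u ∪ η)` and
  Schoen's transfer "`(pr₁^*c ∪ pr₂^*u) ∪ pr₂^*η` algebraic and `pr_{1*}pr₂^*(u ∪ η) ≠ 0` ⟹ `c`
  algebraic" for `complexGysin μ` (the tree's `gysin_fst_cupProduct_cupProduct_map_snd`,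
  `mem_algebraicClasses_of_gysin_fst_cupProduct` are the same statements relative to a
  `GysinFormalism`);
* `complexGysin_fst_map_snd_ne_zero` — fibre integrals of non-zero top classes of `B` do not vanish
  (Künneth spanning is the tree's theorem `kunnethSpan_complexBetti`);
* `exists_algebraic_partner_of_hodgeIndex` — the partner class `t`: GRANTED the Hodge index theorem
  for the surface `B` (`hodgeIndex_surface B.X`) and Lefschetz `(1,1)` (`lefschetzOneOne_rational`),
  both NAMED FACTS of the tree, a non-zero rational `(1,1)` class `b = b₊ + b₋` as above has an
  algebraic divisor class `t` with `b₊ ∪ t ≠ 0` and `b₋ ∪ t ≠ 0` (non-degeneracy of the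
  intersection form on `NS(B)_ℚ`, `exists_cup_ne_zero_of_hodgeIndex`, plus conjugation symmetry).

The assembly of `ProductDescent` from these and the upward half is in
`HeckePrymWeilProductDescent.lean`.
-/

noncomputable section

-- every declaration of this problem lives in `Summit.HodgeConjecture.HodgeConjecture.…` (summit = sub-problem)
set_option linter.dupNamespace false

open CategoryTheory MonoidalCategory CartesianMonoidalCategory
open Literature.AlgebraicGeometry Literature.AlgebraicGeometry.HodgeTheory
open Literature.AlgebraicTopology.SingularHomology

namespace Summit.HodgeConjecture.HodgeConjecture.Theorems

/-! ### Complex conjugation is multiplicative -/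

/-- **`conj (a ∪ b) = conj a ∪ conj b`** on `H*(Y; ℂ)`: on Alexander–Whitney cochains,
`conj ((φ ⌣ ψ)(σ)) = conj (φ(σ|front)) · conj (ψ(σ|back))` (Voisin I, Cor. 6.12: conjugation acts
on `Hᵏ(X, ℂ) = Hᵏ(X, ℝ) ⊗ ℂ`, compatibly with the real cup product). -/
theorem conjClass_cupProduct {Y : Type} [TopologicalSpace Y] {p q m : ℕ} (h : p + q = m)
    (a : singularCohomology ℂ ℂ Y p) (b : singularCohomology ℂ ℂ Y q) :
    conjClass Y m (cupProduct h a b) = cupProduct h (conjClass Y p a) (conjClass Y q b) := by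
  induction a using singularCohomology_induction_on with
  | h za =>
    induction b using singularCohomology_induction_on with
    | h zb =>
      rw [cupProduct_π_π, conjClass_π, conjClass_π, conjClass_π, cupProduct_π_π]
      refine congrArg _ (singularCochainComplex.cocycles_ext ?_)
      rw [iCocycles_conjCocycle, singularCochainComplex.iCocycles_cocyclesCup,
        singularCochainComplex.iCocycles_cocyclesCup, iCocycles_conjCocycle, iCocycles_conjCocycle]
      exact singularCochainComplex.ext fun σ ↦ by
        simp only [conjCochain_apply, cochainCup_apply, map_mul]

/-! ### Eigencomponents of a rational class under a real operator -/

/-- **Conjugation swaps the two eigencomponents of a real class.** Let `f : Y' → Y'` be continuous,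
`T = f^*` on `Hᵏ(Y'; ℂ)`, and `b = b₊ + b₋` a RATIONAL class with `T b₊ = α • b₊`, `T b₋ = ᾱ • b₋`
and `α ≠ ᾱ`. Then `conj b₊ = b₋`: `conj` commutes with `T` (`conjClass_map`) and is conjugate-linear,
so `conj b₊ ∈ Eig(T, ᾱ)`, `conj b₋ ∈ Eig(T, α)`, and `conj b = b` (`IsRationalClass.conjClass_eq`)
gives `(conj b₋ - b₊) + (conj b₊ - b₋) = 0` with summands in `Eig(T, α)`, `Eig(T, ᾱ)`, which meet
in `0`. -/
theorem conjClass_eigencomponent_eq {Y : Type} [TopologicalSpace Y] (f : C(Y, Y)) {k : ℕ}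
    {α : ℂ} (hα : α ≠ starRingEnd ℂ α) {bp bm : singularCohomology ℂ ℂ Y k}
    (hbp : singularCohomology.map ℂ ℂ f k bp = α • bp)
    (hbm : singularCohomology.map ℂ ℂ f k bm = starRingEnd ℂ α • bm)
    (hr : IsRationalClass (bp + bm)) : conjClass Y k bp = bm := by
  set T := (singularCohomology.map ℂ ℂ f k).hom with hT
  have hTapp : ∀ c, T c = singularCohomology.map ℂ ℂ f k c := fun _ ↦ rfl
  -- `conj bp ∈ Eig(ᾱ)`, `conj bm ∈ Eig(α)`
  have h₁ : T (conjClass Y k bp) = starRingEnd ℂ α • conjClass Y k bp := by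
    rw [hTapp, ← conjClass_map, hbp, conjClass_smul]
  have h₂ : T (conjClass Y k bm) = α • conjClass Y k bm := by
    rw [hTapp, ← conjClass_map, hbm, conjClass_smul, starRingEnd_self_apply]
  -- `conj b = b`
  have hreal : conjClass Y k bp + conjClass Y k bm = bp + bm := by
    rw [← conjClass_add, hr.conjClass_eq]
  -- the differences
  set x := conjClass Y k bm - bp with hx
  set y := conjClass Y k bp - bm with hy
  have hTx : T x = α • x := by rw [hx, map_sub, h₂, hTapp bp, hbp, smul_sub]
  have hTy : T y = starRingEnd ℂ α • y := by rw [hy, map_sub, h₁, hTapp bm, hbm, smul_sub]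
  have hxy : x + y = 0 := by
    calc x + y = (conjClass Y k bp + conjClass Y k bm) - (bp + bm) := by rw [hx, hy]; abel
      _ = 0 := by rw [hreal, sub_self]
  have hyx : y = -x := eq_neg_of_add_eq_zero_right hxy
  -- `x ∈ Eig(α) ∩ Eig(ᾱ) = 0`
  have hTy' : T y = α • y := by rw [hyx, map_neg, hTx, smul_neg]
  have hzero : (α - starRingEnd ℂ α) • y = 0 := by rw [sub_smul, ← hTy, ← hTy', sub_self]
  have hy0 : y = 0 := by
    rcases smul_eq_zero.mp hzero with h | h
    · exact absurd (sub_eq_zero.mp h) hα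
    · exact h
  exact sub_eq_zero.mp (hy ▸ hy0)

/-! ### Schoen's transfer along `complexGysin μ` -/

section Transfer

variable (μ : OrientationFamily) {A₁ A₂ : Motives.AbelianVariety ℂ} {m₁ m₂ : ℕ}

/-- **`pr_{1*}((pr₁^* c ∪ pr₂^* u) ∪ pr₂^* η) = c ∪ pr_{1*} pr₂^*(u ∪ η)`** on `A₁ × A₂` along the
tree's real Gysin morphism `complexGysin μ` of the first projection (`dim Aᵢ = mᵢ`,
`deg u + deg η = 2m₂`): associativity and naturality of `∪` and the projection formula
`complexGysin_cup` (Fulton, App. B (6); Poincaré duality for `μ` is the tree's theorem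
`OrientationFamily.hasPoincareDuality`). The `GysinFormalism`-relative form is the tree's
`gysin_fst_cupProduct_cupProduct_map_snd`. -/
theorem complexGysin_fst_cupProduct_cupProduct_map_snd (hA₁ : Motives.IsSmoothProjective m₁ A₁.X)
    (hA₂ : Motives.IsSmoothProjective m₂ A₂.X) {k j j' s t : ℕ} (hkj : k + j = s)
    (hjj' : j + j' = 2 * m₂) (hst : s + j' = t) (c : complexBetti A₁.X k) (u : complexBetti A₂.X j)
    (η : complexBetti A₂.X j') :
    complexGysin μ (Motives.IsSmoothProjective.tensor_holds hA₁ hA₂) hA₁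
        (Motives.AbelianVariety.fst A₁ A₂).hom.hom.hom
        (show t + 2 * m₁ = k + 2 * (m₁ + m₂) by omega)
        (cupProduct hst
          (cupProduct hkj (complexBetti.map (Motives.AbelianVariety.fst A₁ A₂).hom.hom.hom k c)
            (complexBetti.map (Motives.AbelianVariety.snd A₁ A₂).hom.hom.hom j u))
          (complexBetti.map (Motives.AbelianVariety.snd A₁ A₂).hom.hom.hom j' η)) =
      cupProduct (Nat.add_zero k) c
        (complexGysin μ (Motives.IsSmoothProjective.tensor_holds hA₁ hA₂) hA₁
          (Motives.AbelianVariety.fst A₁ A₂).hom.hom.hom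
          (show 2 * m₂ + 2 * m₁ = 0 + 2 * (m₁ + m₂) by omega)
          (complexBetti.map (Motives.AbelianVariety.snd A₁ A₂).hom.hom.hom (2 * m₂)
            (cupProduct hjj' u η))) := by
  rw [cupProduct_assoc hkj hjj' hst (by omega), ← cupProduct_map]
  exact complexGysin_cup (OrientationFamily.hasPoincareDuality μ) _ hA₁ _
    (show k + 2 * m₂ = t by omega) _ _ (Nat.add_zero k) c _

/-- **Schoen's transfer (§10 of the Addendum) along `complexGysin μ`.** Let `A₁`, `A₂` be complex
abelian varieties, smooth projective of dimensions `m₁`, `m₂`, `c ∈ H^{2l}(A₁(ℂ); ℂ)`,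
`u ∈ Hʲ(A₂(ℂ); ℂ)`, `η ∈ H^{j'}(A₂(ℂ); ℂ)` with `j + j' = 2m₂`. IF `(pr₁^* c ∪ pr₂^* u) ∪ pr₂^* η` is
algebraic on `A₁ × A₂` (codimension `l + m₂`) AND the fibre integral
`pr_{1*} pr₂^*(u ∪ η) ∈ H⁰(A₁(ℂ); ℂ)` is non-zero, THEN `c` is algebraic: push-forwards of algebraic
classes along `complexGysin μ` are algebraic (`complexGysin_mem_algebraicClasses`; the Borel–Moore
base change is the tree's theorem `gysinMap_restrictCompl_eq_zero_of_field ℂ`), the push-forward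
equals `c ∪ pr_{1*} pr₂^*(u ∪ η)` (`complexGysin_fst_cupProduct_cupProduct_map_snd`), and
`pr_{1*} pr₂^*(u ∪ η) = ε · 1` (`exists_eq_smul_one`) with `ε ≠ 0`. The `GysinFormalism`-relative
form is the tree's `mem_algebraicClasses_of_gysin_fst_cupProduct`. -/
theorem mem_algebraicClasses_of_complexGysin_fst_cupProduct (hA₁ : Motives.IsSmoothProjective m₁ A₁.X)
    (hA₂ : Motives.IsSmoothProjective m₂ A₂.X) {l j j' s : ℕ} (hkj : 2 * l + j = s)
    (hjj' : j + j' = 2 * m₂) {c : complexBetti A₁.X (2 * l)} {u : complexBetti A₂.X j}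
    {η : complexBetti A₂.X j'}
    (hne : complexGysin μ (Motives.IsSmoothProjective.tensor_holds hA₁ hA₂) hA₁
        (Motives.AbelianVariety.fst A₁ A₂).hom.hom.hom
        (show 2 * m₂ + 2 * m₁ = 0 + 2 * (m₁ + m₂) by omega)
        (complexBetti.map (Motives.AbelianVariety.snd A₁ A₂).hom.hom.hom (2 * m₂)
          (cupProduct hjj' u η)) ≠ 0)
    (halg : cupProduct (show s + j' = 2 * (l + m₂) by omega)
        (cupProduct hkj (complexBetti.map (Motives.AbelianVariety.fst A₁ A₂).hom.hom.hom (2 * l) c)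
          (complexBetti.map (Motives.AbelianVariety.snd A₁ A₂).hom.hom.hom j u))
        (complexBetti.map (Motives.AbelianVariety.snd A₁ A₂).hom.hom.hom j' η) ∈
          algebraicClasses (A₁.prod A₂).X (l + m₂)) :
    c ∈ algebraicClasses A₁.X l := by
  have hμ : μ.HasPoincareDuality := OrientationFamily.hasPoincareDuality μ
  have h1 := complexGysin_mem_algebraicClasses (gysinMap_restrictCompl_eq_zero_of_field ℂ) μ hμ
    (Motives.IsSmoothProjective.tensor_holds hA₁ hA₂) hA₁ (Motives.AbelianVariety.fst A₁ A₂).hom.hom.hom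
    (q := l + m₂) (p := l) (by omega) (by omega) halg
  rw [complexGysin_fst_cupProduct_cupProduct_map_snd μ hA₁ hA₂ hkj hjj'] at h1
  set w := complexGysin μ (Motives.IsSmoothProjective.tensor_holds hA₁ hA₂) hA₁
        (Motives.AbelianVariety.fst A₁ A₂).hom.hom.hom
        (show 2 * m₂ + 2 * m₁ = 0 + 2 * (m₁ + m₂) by omega)
        (complexBetti.map (Motives.AbelianVariety.snd A₁ A₂).hom.hom.hom (2 * m₂)
          (cupProduct hjj' u η)) with hw
  obtain ⟨ε, hε⟩ := exists_eq_smul_one μ hA₁ w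
  rw [hε, map_smul, cupProduct_one] at h1
  have hε0 : ε ≠ 0 := fun h ↦ hne (by rw [hε, h, zero_smul])
  have h3 := Submodule.smul_mem (algebraicClasses A₁.X l) ε⁻¹ h1
  rwa [smul_smul, inv_mul_cancel₀ hε0, one_smul] at h3

/-- **A non-zero top class of `Z` has non-zero fibre integral over `X × Z → X`** (smooth
projective `X`, `Z` of dimensions `l`, `n`): for `0 ≠ w ∈ H²ⁿ(Z(ℂ); ℂ)`, `(pr_X)_* pr_Z^* w ≠ 0` in
`H⁰(X(ℂ); ℂ)`. This is `complexGysin_fst_map_snd_ne_zero_of_kunneth` of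
`Theorems/HeckePrymWeilWeilDescendingUpward` with its Künneth hypothesis DISCHARGED by the tree's
theorem `kunnethSpan_complexBetti` (proof repeated verbatim: if the fibre integral vanished, every
top-degree cross product `fst^* a ∪ snd^* w'`, `w' ∈ H²ⁿ(Z(ℂ)) = ℂ · w`, would pair to zero with
`[X × Z] ≠ 0` — graded commutativity, `⟨s ∪ t, σ⟩ = ⟨t, s ⌢ σ⟩`, naturality and the defining square
of `complexGysin` —, cross products of the other bidegrees vanish, so the Kronecker pairing with
`[X × Z]` would kill all of `H^{2(l+n)}`, contradicting universal coefficients over `ℂ`). -/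
theorem complexGysin_fst_map_snd_ne_zero_schemeOver {l n : ℕ} {X Z : Motives.SchemeOver ℂ}
    (hX : Motives.IsSmoothProjective l X) (hZ : Motives.IsSmoothProjective n Z)
    {w : complexBetti Z (2 * n)} (hw : w ≠ 0) :
    complexGysin μ (Motives.IsSmoothProjective.tensor_holds hX hZ) hX (fst X Z)
        (show 2 * n + 2 * l = 0 + 2 * (l + n) by omega) (complexBetti.map (snd X Z) (2 * n) w) ≠ 0 := by
  have hμ : μ.HasPoincareDuality := OrientationFamily.hasPoincareDuality μ
  have hT := Motives.IsSmoothProjective.tensor_holds hX hZ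
  letI := hT.chartedSpace
  haveI := Motives.ComplexPoints.compactSpace_of_isSmoothProjective hT
  haveI := Motives.ComplexPoints.t2Space_of_isSmoothProjective hT
  haveI := connectedSpace_complexPoints hT
  intro h0
  set κ := kroneckerPairing ℂ ℂ (Motives.ComplexPoints (X ⊗ Z)) (2 * (l + n)) with hκ
  have hne : (μ hT).fundamentalClass ≠ 0 := fundamentalClass_ne_zero (μ hT)
  obtain ⟨θ, hθ⟩ : ∃ θ : Module.Dual ℂ (singularHomology ℂ ℂ (Motives.ComplexPoints (X ⊗ Z))
      (2 * (l + n))), θ (μ hT).fundamentalClass ≠ 0 := by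
    by_contra h
    push Not at h
    exact hne ((Module.forall_dual_apply_eq_zero_iff ℂ _).1 h)
  obtain ⟨G₀, hG₀⟩ := kroneckerPairing_surjective ℂ (Motives.ComplexPoints (X ⊗ Z)) (2 * (l + n)) θ
  have hG₀ne : κ G₀ (μ hT).fundamentalClass ≠ 0 := by rw [hκ, hG₀]; exact hθ
  apply hG₀ne
  -- every top-degree cross product `fst^* a ∪ snd^* w'`, `w' ∈ H²ⁿ(Z(ℂ)) = ℂ · w`, pairs to zero with `[T]`
  have key : ∀ (a : complexBetti X (2 * l)) (w' : complexBetti Z (2 * n)),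
      κ (cupProduct (two_mul_add_two_mul l n) (complexBetti.map (fst X Z) (2 * l) a)
        (complexBetti.map (snd X Z) (2 * n) w')) (μ hT).fundamentalClass = 0 := by
    intro a w'
    obtain ⟨t, rfl⟩ := exists_eq_smul_of_top μ hZ hw w'
    have hsign : ((-1 : ℂ) ^ (2 * l * (2 * n))) = 1 := Even.neg_one_pow ⟨l * (2 * n), by ring⟩
    rw [map_smul, map_smul, map_smul, LinearMap.smul_apply, smul_eq_mul]
    refine mul_eq_zero_of_right t ?_
    rw [cupProduct_gradedComm_holds ℂ _ _ (show 2 * n + 2 * l = 2 * (l + n) by omega), hsign,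
      one_smul, hκ, kroneckerPairing_cupProduct]
    change kroneckerPairing ℂ ℂ _ _ (singularCohomology.map ℂ ℂ
      (Motives.AlgPoints.mapContinuous (L := ℂ) (fst X Z)) _ a) _ = 0
    rw [kroneckerPairing_map, ← capProduct_complexGysin hμ hT hX (fst X Z)
      (show 2 * n + 2 * l = 0 + 2 * (l + n) by omega) _ (Nat.zero_add _), h0,
      map_zero, LinearMap.zero_apply, map_zero]
  have hle : Submodule.span ℂ {v | ∃ (i j : ℕ) (h : i + j = 2 * (l + n)) (a : complexBetti X i)
        (w : complexBetti Z j),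
        v = cupProduct h (complexBetti.map (fst X Z) i a) (complexBetti.map (snd X Z) j w)} ≤
      LinearMap.ker (κ.flip (μ hT).fundamentalClass) := by
    refine Submodule.span_le.2 ?_
    rintro _ ⟨i, j, h, a, v, rfl⟩
    rw [SetLike.mem_coe, LinearMap.mem_ker, LinearMap.flip_apply]
    rcases lt_trichotomy (2 * l) i with hi | hi | hi
    · haveI := subsingleton_complexBetti hX hi
      rw [Subsingleton.elim a 0, map_zero, map_zero, LinearMap.zero_apply, map_zero,
        LinearMap.zero_apply]
    swap
    · haveI := subsingleton_complexBetti hZ (show 2 * n < j by omega)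
      rw [Subsingleton.elim v 0, map_zero, map_zero, map_zero, LinearMap.zero_apply]
    subst hi
    obtain rfl : j = 2 * n := by omega
    exact key a v
  have hmem := hle (kunnethSpan_complexBetti hX hZ (2 * (l + n)) G₀)
  rwa [LinearMap.mem_ker, LinearMap.flip_apply] at hmem

/-- **A non-zero top class of `A₂` has non-zero fibre integral over `A₁ × A₂ → A₁`**: for
`0 ≠ y ∈ H^{2m₂}(A₂(ℂ); ℂ)`, `pr_{1*} pr₂^* y ≠ 0` in `H⁰(A₁(ℂ); ℂ)` — the abelian-variety typing of
`complexGysin_fst_map_snd_ne_zero_schemeOver` (`(A₁.prod A₂).X = A₁.X ⊗ A₂.X` and the projections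
agree definitionally). This is Schoen's "surjectivity" input once `y = u ∪ η ≠ 0`. -/
theorem complexGysin_fst_map_snd_ne_zero (hA₁ : Motives.IsSmoothProjective m₁ A₁.X)
    (hA₂ : Motives.IsSmoothProjective m₂ A₂.X) {y : complexBetti A₂.X (2 * m₂)} (hy : y ≠ 0) :
    complexGysin μ (Motives.IsSmoothProjective.tensor_holds hA₁ hA₂) hA₁
        (Motives.AbelianVariety.fst A₁ A₂).hom.hom.hom
        (show 2 * m₂ + 2 * m₁ = 0 + 2 * (m₁ + m₂) by omega)
        (complexBetti.map (Motives.AbelianVariety.snd A₁ A₂).hom.hom.hom (2 * m₂) y) ≠ 0 :=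
  complexGysin_fst_map_snd_ne_zero_schemeOver μ hA₁ hA₂ hy

end Transfer

/-! ### The partner divisor class on the surface (Hodge index + Lefschetz (1,1)) -/

/-- **The algebraic partner of a rational Weil-plane class on a surface.** Let `B` be a smooth
projective surface, `g : B → B` a morphism, `b = b₊ + b₋ ≠ 0` a RATIONAL class of Hodge type `(1,1)`
in `H²(B(ℂ); ℂ)` with `g^* b₊ = α b₊`, `g^* b₋ = ᾱ b₋`, `α ≠ ᾱ`. GRANTED the Hodge index theorem for
`B` (`hodgeIndex_surface B`) and Lefschetz `(1,1)` (`lefschetzOneOne_rational`) — two NAMED FACTS of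
the tree — there is an ALGEBRAIC class `t ∈ N¹ H²(B(ℂ); ℂ)` with `b₊ ∪ t ≠ 0` and `b₋ ∪ t ≠ 0`:
the intersection form on the rational `(1,1)`-classes is non-degenerate
(`exists_cup_ne_zero_of_hodgeIndex`: a rational divisor class `t` with `b ∪ t ≠ 0`), and
`b₋ ∪ t = conj (b₊ ∪ t)` (`conjClass_eigencomponent_eq`, `conjClass_cupProduct`, `t` real), so
both summands of `b ∪ t = b₊ ∪ t + b₋ ∪ t ≠ 0` are non-zero. This is the form in which "the pairing
on `NS(B) ⊗ ℂ ∋ b₊` is non-degenerate" (Schoen's surjectivity, §10) enters on the carriers. -/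
theorem exists_algebraic_partner_of_hodgeIndex {B : Motives.SchemeOver ℂ}
    (hHI : hodgeIndex_surface B) (hL : lefschetzOneOne_rational) (hB : Motives.IsSmoothProjective 2 B)
    (g : B ⟶ B) {α : ℂ} (hα : α ≠ starRingEnd ℂ α) {bp bm : complexBetti B 2}
    (hbp : complexBetti.map g 2 bp = α • bp) (hbm : complexBetti.map g 2 bm = starRingEnd ℂ α • bm)
    (hr : IsRationalClass (bp + bm)) (h11 : IsOfHodgeType 2 B 2 1 1 (bp + bm)) (h0 : bp + bm ≠ 0) :
    ∃ t : complexBetti B 2, t ∈ algebraicClasses B 1 ∧ cupProduct two_add_two bp t ≠ 0 ∧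
      cupProduct two_add_two bm t ≠ 0 := by
  obtain ⟨t, ht, -, htalg, hbt⟩ := exists_cup_ne_zero_of_hodgeIndex hHI hL hB (bp + bm) hr h11 h0
  have hconj : conjClass (Motives.ComplexPoints B) 2 bp = bm :=
    conjClass_eigencomponent_eq (Motives.AlgPoints.mapContinuous (L := ℂ) g) hα hbp hbm hr
  have hm : cupProduct two_add_two bm t = conjClass (Motives.ComplexPoints B) 4 (cupProduct two_add_two bp t) := by
    rw [conjClass_cupProduct, hconj, ht.conjClass_eq]
  have hp : cupProduct two_add_two bp t ≠ 0 := by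
    intro h
    apply hbt
    rw [map_add, LinearMap.add_apply, hm, h, conjClass_zero, add_zero]
  refine ⟨t, htalg, hp, ?_⟩
  rw [hm]
  intro h
  apply hp
  rw [← conjClass_conjClass (cupProduct two_add_two bp t), h, conjClass_zero]

end Summit.HodgeConjecture.HodgeConjecture.Theorems

end
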